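/-
Copyright (c) 2026 the pub-hodgecm-mathlib formalisation cell (harness21).  Prover seat hodgecm-mathlib-K2E5-p17 (g4), Track B «K2-LIT» ∕ h413
(`stmt-HodgeConjecture-24833`), line `K2_E3_EllipticInputs`, unit U12 §L, Richardson road for (LBGL-ge3) at `N = 3` (road owner K2E3-p11 (g5), ROAD v2,
brick F″ «PARAHORIC LEVEL MEASURE», HANDS BY NAME 2026-09-04T06:00:55Z (3), frozen head adopted 06:01:18Z), part 2 of 2: «THE HAAR MEASURE OF `GL₃(𝒪)`
RESTRICTED TO THE LEVEL-`𝔭^j` PARAHORIC SET, AGAINST RIGHT-`(K ∩ P)`-INVARIANT FUNCTIONS, IS `c · dz` ON `(𝔭^j)²`».  2026-09-04.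
-/
import Summits.HodgeConjecture.HodgeConjecture.Theorems.K2E3GL3ParahoricLevelMeasureLemmas    -- ★ part 1 (this seat): skew-product algebra, `skewRow_mem_iff`, the two `‖d(a)‖ = 1` criteria
import Summits.HodgeConjecture.HodgeConjecture.Theorems.K2E3GLnIntegerPointsHaarVsAddHaar      -- ★ C p857560 (K2E3-p06): `exists_lintegral_glInt_eq_mul_setLIntegral` (`κ = c₀ · μ𝔤|_S` on `GL_N(𝒪)`)
import Literature.MeasureTheory.Group.LocalFieldLinearJacobian                                -- ★ `lintegral_comp_linearEquiv` (`∫ f∘L = mod(det L)⁻¹ ∫ f` on `F^d`)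
import Literature.NumberTheory.Automorphic.LocalRingUnitModulusProduct                         -- ★ `UnitaryGroup.distribHaarChar_eq_normAbs`
import Mathlib.MeasureTheory.Constructions.Pi
import HarnessLib

/-!
# K2_E3 road (h413), §L — Richardson road at `N = 3`, brick F″: the level-`𝔭^j` parahoric set of `K = GL₃(𝒪)` against right-`(K ∩ P)`-invariant functions

Cell `pub/hodgecm-mathlib` (D-0151), Track B, seat K2E5-p17 (g4) (free E5 hand serving the E3 road by name); road owner K2E3-p11 (g5), §L lead K2E3-p12 (g5),
dealer K2E3-plan (g3).  `--supports stmt-HodgeConjecture-24833 --as helper`; THEOREMS ONLY (no definition ∕ instance ∕ notation ∕ named fact ∕ `sorry`); never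
imports `Cruxes/…/Lines`.  COUNT-NEUTRAL ((LBGL-ge3) ∕ (LBGL-3E) stay OPEN).  Consumer: G″ `K2E3GL3ParabolicSliceLocalPullback` (K2E3-p11 (g5)): after the fibre
separation `Ad(k)P ∈ M₀ + box ⇒ k ∈ w_j·(1 + L z)·(K ∩ P)`, the `K`-integral of the right-`(K∩P)`-invariant `Θ(k) = ∫_{F⁷} (f·1_B)(Ad(k)P(r)) dr` over each
level set becomes `c · ∫_{(𝔭^j)²} Θ(w_j (1 + L z)) dz` with ONE `c` for all levels `j ≥ 1`.

THE HEAD (road owner's frozen bytes) `exists_lintegral_glInt_lowerLevel_eq`: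
  `∃ c ≠ 0, ∞: ∀ j ≥ 1, ∀ Θ ≥ 0` Borel on `M₃(F)` with `Θ(g p) = Θ(g)` for `p ∈ M₃(𝒪)`, `‖det p‖ = 1`, `p₂₀ = p₂₁ = 0`:
  `∫_{k ∈ GL₃(𝒪), k₂₀, k₂₁ ∈ 𝔭^j} Θ(k) dκ = c · ∫_{z ∈ (𝔭^j)²} Θ(1 + L z) dz`,  `L z = [[0,0,0],[0,0,0],[z₀,z₁,0]]`.

THE PROOF (skew product over the rows `0, 1`, after the road owner's hint; no modular function, no quotient measure).  `S = {X ∈ M₃(𝒪) | ‖det X‖ = 1}`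
(= `GL₃(𝒪)` in `M₃(F)`), `T_j = {X₂₀, X₂₁ ∈ 𝔭^j}`, `μ𝔤 = dx^{⊗3} ⊗ dx^{⊗3} ⊗ dx^{⊗3}` (rows) on `M₃(F) = F^{3×3}`.
(1) ★ C: `∫_{K ∩ T_j} Θ dκ = c₀ · ∫ 1_{S ∩ T_j} Θ dμ𝔤`.  (2) Split off the last row (`measurePreserving_piFinSuccAbove … 2`, Tonelli): `= c₀ ∫_a I(a) da`,
`a = (a₀, a₁) ∈ F^{2×3}`, `I(a) = ∫_{c ∈ F³} (1_{S∩T_j}Θ)[a₀; a₁; c] dc`.  (3) THE FIBRE (§1 `lintegral_fibre_levelIndicator_eq`): if `‖d(a)‖ = 1` (`d(a) = det` of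
the top-left `2×2` block) substitute `c = Λ_a(z,t) = (z·B(a), z·(a₀₂,a₁₂) + t)` — LINEAR, `det Λ_a = d(a)`, module `‖d(a)‖ = 1` (★ `lintegral_comp_linearEquiv`, ★
`distribHaarChar_eq_normAbs`); then `[a₀; a₁; Λ_a(z,t)] = (1 + L z)·P̃(a,t)` lies in `S ∩ T_j` iff `z ∈ (𝔭^j)²` and `P̃(a,t) ∈ S` (★ part 1 `skewRow_mem_iff`) and
there `Θ = Θ(1 + L z)` by right-invariance, so `I(a) = (∫_{(𝔭^j)²} Θ(1+Lz) dz) · dx{t | P̃(a,t) ∈ S}` (second split `F³ = F × F²`, `lintegral_prod_mul`); if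
`‖d(a)‖ ≠ 1` both sides vanish (★ part 1: `S ∩ T_j` forces `‖d(a)‖ = 1` when `j ≥ 1`; `det P̃ = t·d(a)`).  (4) `c = c₀ · V`, `V = ∫_a dx{t | P̃(a,t) ∈ S} da`
is level-free; `c ≠ 0, ∞` is read off the identity at `j = 1, Θ = 1` (`0 < κ(K ∩ T₁) < ∞`, `0 < dx(𝔭)² < ∞`).
[WeilBNT1967, Ch. I §2 (module of a linear automorphism), Ch. II §2]; [Macdonald1971, (1.4), (2.1) (parahoric subgroups of `GL_n`, Iwahori factorisation)];
[BushnellHenniart2006, §7.2 (`U_𝔄^j`)]; [HarishChandra1970, Part V §2 p. 49].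

HONEST LABEL: HC_CM is proved only modulo the 7 printed citations (2 remaining named inputs: hLiu418 = stmt-HodgeConjecture-24832, h413 = stmt-HodgeConjecture-24833)
until rung 0 closes; count-neutral helper.
-/

set_option autoImplicit false
set_option linter.dupNamespace false   -- `Summit.HodgeConjecture.HodgeConjecture.…` (D-0017 nested layout; lakefile exemption for Summits)

noncomputable section

open MeasureTheory MeasureTheory.Measure Set Matrix Topology ValuativeRel Function
open scoped NNReal ENNReal MatrixGroups
open Literature.NumberTheory.GaloisRepresentations Literature.NumberTheory.GaloisRepresentations.IsNonarchimedeanLocalField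
open Literature.NumberTheory.Automorphic Literature.NumberTheory.Automorphic.LocalFieldHaar Literature.MeasureTheory.Group
open Summit.HodgeConjecture.HodgeConjecture.Cruxes.H413.K2E3GL3ParahoricLevelMeasureLemmas
open Summit.HodgeConjecture.HodgeConjecture.Cruxes.H413.K2E3GLnIntegerPointsHaarVsAddHaar

namespace Summit.HodgeConjecture.HodgeConjecture.Cruxes.H413.K2E3GL3ParahoricLevelMeasure

/-! ## §0  Coordinates: splitting off the last row of `F^{3×3}` and of `F³` -/

section Coordinates

variable {K : Type*} [MeasurableSpace K]

/-- The inverse of the «split off row `2`» equivalence `K^{3×3} ≃ K³ × K^{2×3}` reassembles `(c, a) ↦ [a₀; a₁; c]`. [folklore] -/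
theorem piFinSuccAbove_rows_symm_apply (c : Fin 3 → K) (a : Fin 2 → Fin 3 → K) :
    (MeasurableEquiv.piFinSuccAbove (fun _ : Fin 3 => Fin 3 → K) 2).symm (c, a) = ![a 0, a 1, c] := by
  funext i
  fin_cases i <;> simp [MeasurableEquiv.piFinSuccAbove, Fin.insertNthEquiv, Fin.insertNth, Fin.succAboveCases]

/-- The inverse of the «split off coordinate `2`» equivalence `K³ ≃ K × K²` reassembles `(t, z) ↦ (z₀, z₁, t)`. [folklore] -/
theorem piFinSuccAbove_entries_symm_apply (t : K) (z : Fin 2 → K) :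
    (MeasurableEquiv.piFinSuccAbove (fun _ : Fin 3 => K) 2).symm (t, z) = ![z 0, z 1, t] := by
  funext i
  fin_cases i <;> simp [MeasurableEquiv.piFinSuccAbove, Fin.insertNthEquiv, Fin.insertNth, Fin.succAboveCases]

end Coordinates

variable {F : Type*} [Field F] [ValuativeRel F] [TopologicalSpace F] [IsNonarchimedeanLocalField F]

/-! ## §1  The fibre over the first two rows -/

omit [ValuativeRel F] [IsNonarchimedeanLocalField F] in
/-- Continuity of `t ↦ P̃(a,t) = [a₀; a₁; (0,0,t)]`. [folklore] -/
theorem continuous_parabolicRow (a : Fin 2 → Fin 3 → F) :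
    Continuous fun t : F => (Matrix.of ![a 0, a 1, ![0, 0, t]] : Matrix (Fin 3) (Fin 3) F) := by
  refine continuous_matrix fun i j => ?_
  fin_cases i <;> fin_cases j <;> simp <;> fun_prop

omit [Field F] [ValuativeRel F] [IsNonarchimedeanLocalField F] in
/-- Continuity of `c ↦ [a₀; a₁; c]`. [folklore] -/
theorem continuous_ofRows (a : Fin 2 → Fin 3 → F) :
    Continuous fun c : Fin 3 → F => (Matrix.of ![a 0, a 1, c] : Matrix (Fin 3) (Fin 3) F) := by
  refine continuous_matrix fun i j => ?_
  fin_cases i <;> simp <;> fun_prop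

/-- Continuity of `z ↦ 1 + L z`. [folklore] -/
theorem continuous_one_add_lowerRow :
    Continuous fun z : Fin 2 → F => (1 + !![0, 0, 0; 0, 0, 0; z 0, z 1, 0] : Matrix (Fin 3) (Fin 3) F) := by
  haveI : IsTopologicalRing F := inferInstance
  refine continuous_const.add (continuous_matrix fun i j => ?_)
  fin_cases i <;> fin_cases j <;> simp <;> fun_prop

variable [MeasurableSpace F] [BorelSpace F]




/-- **THE FIBRE IDENTITY.**  For rows `a = (a₀, a₁)`, a level `j ≥ 1` and a right-`(K∩P)`-invariant Borel `Θ ≥ 0`: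
`∫_{c ∈ F³} (1_{S ∩ T_j} Θ)[a₀; a₁; c] dc = (∫_{(𝔭^j)²} Θ(1 + L z) dz) · dx{t | P̃(a,t) ∈ S}`
(linear substitution `c = Λ_a(z,t)` of module `‖d(a)‖ = 1` when the top-left block is unimodular; both sides vanish otherwise).
[cite: WeilBNT1967, Ch. I §2] [cite: Macdonald1971, (2.1)] -/
theorem lintegral_fibre_levelIndicator_eq (dx : Measure F) [dx.IsAddHaarMeasure] {j : ℕ} (hj : 1 ≤ j)
    (Θ : Matrix (Fin 3) (Fin 3) F → ℝ≥0∞)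
    (hΘ : ∀ g p : Matrix (Fin 3) (Fin 3) F, (∀ i l, p i l ∈ 𝒪[F]) → normAbs F p.det = 1 → p 2 0 = 0 → p 2 1 = 0 → Θ (g * p) = Θ g)
    [MeasurableSpace (Matrix (Fin 3) (Fin 3) F)] [BorelSpace (Matrix (Fin 3) (Fin 3) F)] (hΘm : Measurable Θ) (a : Fin 2 → Fin 3 → F) :
    ∫⁻ c : Fin 3 → F, ({X : Matrix (Fin 3) (Fin 3) F | (∀ i l, X i l ∈ 𝒪[F]) ∧ normAbs F X.det = 1} ∩
          {X : Matrix (Fin 3) (Fin 3) F | X 2 0 ∈ primePowBall F (j : ℤ) ∧ X 2 1 ∈ primePowBall F (j : ℤ)}).indicator Θ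
          (Matrix.of ![a 0, a 1, c]) ∂(Measure.pi fun _ : Fin 3 => dx) =
      (∫⁻ z in Set.univ.pi (fun _ : Fin 2 => primePowBall F (j : ℤ)), Θ (1 + !![0, 0, 0; 0, 0, 0; z 0, z 1, 0]) ∂(Measure.pi fun _ : Fin 2 => dx)) *
        dx {t : F | (Matrix.of ![a 0, a 1, ![0, 0, t]] : Matrix (Fin 3) (Fin 3) F) ∈
          {X : Matrix (Fin 3) (Fin 3) F | (∀ i l, X i l ∈ 𝒪[F]) ∧ normAbs F X.det = 1}} := by
  classical
  haveI : T2Space F := (isLocalField F).toT2Space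
  haveI : LocallyCompactSpace F := (isLocalField F).toLocallyCompactSpace
  haveI : SecondCountableTopology F := secondCountableTopology_localField F
  set S : Set (Matrix (Fin 3) (Fin 3) F) := {X | (∀ i l, X i l ∈ 𝒪[F]) ∧ normAbs F X.det = 1} with hSdef
  set T : Set (Matrix (Fin 3) (Fin 3) F) := {X | X 2 0 ∈ primePowBall F (j : ℤ) ∧ X 2 1 ∈ primePowBall F (j : ℤ)} with hTdef
  set box : Set (Fin 2 → F) := Set.univ.pi (fun _ : Fin 2 => primePowBall F (j : ℤ)) with hbox
  set Sa : Set F := {t : F | (Matrix.of ![a 0, a 1, ![0, 0, t]] : Matrix (Fin 3) (Fin 3) F) ∈ S} with hSa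
  have hj0 : (0 : ℤ) ≤ (j : ℤ) := Int.natCast_nonneg j
  have hj1 : (1 : ℤ) ≤ (j : ℤ) := by exact_mod_cast hj
  have hSmeas : MeasurableSet S := measurableSet_setOf_integer_normAbs_det_eq_one
  have hSa_meas : MeasurableSet Sa := hSmeas.preimage (continuous_parabolicRow a).measurable
  have hbox_meas : MeasurableSet box := MeasurableSet.univ_pi fun _ => measurableSet_primePowBall _
  -- the two factors of the right-hand side as indicator integrals
  set φ : (Fin 2 → F) → ℝ≥0∞ := box.indicator fun z => Θ (1 + !![0, 0, 0; 0, 0, 0; z 0, z 1, 0]) with hφ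
  set ψ : F → ℝ≥0∞ := Sa.indicator 1 with hψ
  have hφm : Measurable φ := (hΘm.comp continuous_one_add_lowerRow.measurable).indicator hbox_meas
  have hψm : Measurable ψ := measurable_one.indicator hSa_meas
  have hφint : ∫⁻ z, φ z ∂(Measure.pi fun _ : Fin 2 => dx) = ∫⁻ z in box, Θ (1 + !![0, 0, 0; 0, 0, 0; z 0, z 1, 0]) ∂(Measure.pi fun _ : Fin 2 => dx) :=
    lintegral_indicator hbox_meas _
  have hψint : ∫⁻ t, ψ t ∂dx = dx Sa := lintegral_indicator_one hSa_meas
  set d : F := a 0 0 * a 1 1 - a 0 1 * a 1 0 with hd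
  by_cases hdu : normAbs F d = 1
  · -- CASE `‖d(a)‖ = 1`: the linear substitution `c = Λ_a(z, t)`
    have hd0 : d ≠ 0 := fun h0 => by rw [h0, map_zero] at hdu; exact zero_ne_one hdu
    set Λ : Matrix (Fin 3) (Fin 3) F := !![a 0 0, a 1 0, 0; a 0 1, a 1 1, 0; a 0 2, a 1 2, 1] with hΛ
    have hΛdet : Λ.det = d := by rw [hΛ, hd]; exact det_skewMat a
    set L : (Fin 3 → F) ≃ₗ[F] (Fin 3 → F) :=
      Λ.toLinearEquiv' (Matrix.invertibleOfIsUnitDet Λ (by rw [hΛdet]; exact isUnit_iff_ne_zero.2 hd0)) with hL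
    have hLapp : ∀ c : Fin 3 → F, L c = Λ.mulVec c := fun c => by
      show (L : Module.End F (Fin 3 → F)) c = _
      rw [hL, Matrix.toLinearEquiv'_apply, Matrix.toLin'_apply]
    have hLdet : ((LinearEquiv.det L : Fˣ) : F) = d := by
      rw [LinearEquiv.coe_det, show (L : (Fin 3 → F) →ₗ[F] (Fin 3 → F)) = Matrix.toLin' Λ from rfl, LinearMap.det_toLin', hΛdet]
    have hmod : distribHaarChar F (LinearEquiv.det L) = 1 := by
      rw [UnitaryGroup.distribHaarChar_eq_normAbs, hLdet, hdu]
    -- (i) substitute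
    have h1 := Literature.MeasureTheory.Group.lintegral_comp_linearEquiv (Measure.pi fun _ : Fin 3 => dx) L
      (fun c => (S ∩ T).indicator Θ (Matrix.of ![a 0, a 1, c]))
    rw [hmod, inv_one, ENNReal.coe_one, one_mul] at h1
    rw [← h1]
    -- (ii) split `c' = (z₀, z₁, t)`
    let e3 : (Fin 3 → F) ≃ᵐ F × (Fin 2 → F) := MeasurableEquiv.piFinSuccAbove (fun _ : Fin 3 => F) 2
    have he3 : MeasurePreserving e3 (Measure.pi fun _ : Fin 3 => dx) (dx.prod (Measure.pi fun _ : Fin 2 => dx)) :=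
      measurePreserving_piFinSuccAbove (fun _ : Fin 3 => dx) 2
    rw [← he3.symm.lintegral_comp_emb e3.symm.measurableEmbedding]
    -- (iii) the pointwise identity on `F × F²`
    have hpt : ∀ p : F × (Fin 2 → F), (S ∩ T).indicator Θ (Matrix.of ![a 0, a 1, L (e3.symm p)]) = ψ p.1 * φ p.2 := by
      rintro ⟨t, z⟩
      have hrow : L (e3.symm (t, z)) = ![z 0 * a 0 0 + z 1 * a 1 0, z 0 * a 0 1 + z 1 * a 1 1, z 0 * a 0 2 + z 1 * a 1 2 + t] := by
        rw [hLapp, show e3.symm (t, z) = ![z 0, z 1, t] from piFinSuccAbove_entries_symm_apply t z, hΛ]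
        exact skewMat_mulVec_cons a z t
      rw [hrow]
      have hiff := skewRow_mem_iff a z t hj0 hdu
      by_cases hz : ∀ i, z i ∈ primePowBall F (j : ℤ)
      · by_cases hP : (Matrix.of ![a 0, a 1, ![0, 0, t]] : Matrix (Fin 3) (Fin 3) F) ∈ S
        · have hmem : (Matrix.of ![a 0, a 1, ![z 0 * a 0 0 + z 1 * a 1 0, z 0 * a 0 1 + z 1 * a 1 1, z 0 * a 0 2 + z 1 * a 1 2 + t]] :
              Matrix (Fin 3) (Fin 3) F) ∈ S ∩ T := by
            have h := hiff.2 ⟨hz, hP⟩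
            exact ⟨h.1, h.2.1, h.2.2⟩
          have hzbox : z ∈ box := Set.mem_univ_pi.2 hz
          have htS : t ∈ Sa := hP
          rw [Set.indicator_of_mem hmem, hψ, Set.indicator_of_mem htS, hφ, Set.indicator_of_mem hzbox, Pi.one_apply, one_mul,
            of_rows_skewRow_eq a z t]
          exact hΘ _ _ hP.1 hP.2 (by simp) (by simp)
        · have hnot : (Matrix.of ![a 0, a 1, ![z 0 * a 0 0 + z 1 * a 1 0, z 0 * a 0 1 + z 1 * a 1 1, z 0 * a 0 2 + z 1 * a 1 2 + t]] :
              Matrix (Fin 3) (Fin 3) F) ∉ S ∩ T := fun h => hP (hiff.1 ⟨h.1, h.2.1, h.2.2⟩).2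
          have htS : t ∉ Sa := hP
          rw [Set.indicator_of_notMem hnot, hψ, Set.indicator_of_notMem htS, zero_mul]
      · have hnot : (Matrix.of ![a 0, a 1, ![z 0 * a 0 0 + z 1 * a 1 0, z 0 * a 0 1 + z 1 * a 1 1, z 0 * a 0 2 + z 1 * a 1 2 + t]] :
            Matrix (Fin 3) (Fin 3) F) ∉ S ∩ T := fun h => hz (hiff.1 ⟨h.1, h.2.1, h.2.2⟩).1
        have hzbox : z ∉ box := fun h => hz (Set.mem_univ_pi.1 h)
        rw [Set.indicator_of_notMem hnot, hφ, Set.indicator_of_notMem hzbox, mul_zero]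
    simp_rw [hpt]
    rw [lintegral_prod_mul hψm.aemeasurable hφm.aemeasurable, hψint, hφint, mul_comm]
  · -- CASE `‖d(a)‖ ≠ 1`: both sides vanish
    have hL0 : ∀ c : Fin 3 → F, (S ∩ T).indicator Θ (Matrix.of ![a 0, a 1, c]) = 0 := by
      intro c
      refine Set.indicator_of_notMem (fun h => hdu ?_) _
      exact normAbs_topLeftDet_eq_one_of_rows a c hj1 h.1 h.2.1 h.2.2
    have hSa0 : Sa = ∅ := by
      refine Set.eq_empty_iff_forall_notMem.2 fun t ht => hdu ?_
      exact normAbs_topLeftDet_eq_one_of_parabolic a t ht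
    simp_rw [hL0]
    rw [lintegral_zero, hSa0, measure_empty, mul_zero]

/-! ## §2  Tonelli over the first two rows -/

/-- The set `W = {(a, t) | P̃(a,t) ∈ S}` is Borel in `F^{2×3} × F`. [folklore] -/
theorem measurableSet_parabolicRows [MeasurableSpace (Matrix (Fin 3) (Fin 3) F)] [BorelSpace (Matrix (Fin 3) (Fin 3) F)] :
    MeasurableSet {p : (Fin 2 → Fin 3 → F) × F | (Matrix.of ![p.1 0, p.1 1, ![0, 0, p.2]] : Matrix (Fin 3) (Fin 3) F) ∈
      {X : Matrix (Fin 3) (Fin 3) F | (∀ i l, X i l ∈ 𝒪[F]) ∧ normAbs F X.det = 1}} := by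
  haveI : T2Space F := (isLocalField F).toT2Space
  haveI : SecondCountableTopology F := secondCountableTopology_localField F
  have hcont : Continuous fun p : (Fin 2 → Fin 3 → F) × F => (Matrix.of ![p.1 0, p.1 1, ![0, 0, p.2]] : Matrix (Fin 3) (Fin 3) F) := by
    refine continuous_matrix fun i j => ?_
    fin_cases i <;> fin_cases j <;> simp <;> fun_prop
  exact measurableSet_setOf_integer_normAbs_det_eq_one.preimage hcont.measurable

/-- **Tonelli assembly**: `∫_{F^{3×3}} 1_{S ∩ T_j} Θ dμ𝔤 = (∫_{(𝔭^j)²} Θ(1+Lz) dz) · V`, `V = ∫_a dx{t | P̃(a,t) ∈ S} da` (level-free), for the row-product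
measure `μ𝔤 = ⊗_{rows} dx^{⊗3}` on `F^{3×3}`. [cite: WeilBNT1967, Ch. I §2] [cite: Macdonald1971, (2.1)] -/
theorem lintegral_pi_levelIndicator_eq (dx : Measure F) [dx.IsAddHaarMeasure] {j : ℕ} (hj : 1 ≤ j)
    (Θ : Matrix (Fin 3) (Fin 3) F → ℝ≥0∞)
    (hΘ : ∀ g p : Matrix (Fin 3) (Fin 3) F, (∀ i l, p i l ∈ 𝒪[F]) → normAbs F p.det = 1 → p 2 0 = 0 → p 2 1 = 0 → Θ (g * p) = Θ g)
    [MeasurableSpace (Matrix (Fin 3) (Fin 3) F)] [BorelSpace (Matrix (Fin 3) (Fin 3) F)] (hΘm : Measurable Θ) :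
    ∫⁻ X : Fin 3 → Fin 3 → F, ({X : Matrix (Fin 3) (Fin 3) F | (∀ i l, X i l ∈ 𝒪[F]) ∧ normAbs F X.det = 1} ∩
          {X : Matrix (Fin 3) (Fin 3) F | X 2 0 ∈ primePowBall F (j : ℤ) ∧ X 2 1 ∈ primePowBall F (j : ℤ)}).indicator Θ (Matrix.of X)
        ∂(Measure.pi fun _ : Fin 3 => Measure.pi fun _ : Fin 3 => dx) =
      (∫⁻ z in Set.univ.pi (fun _ : Fin 2 => primePowBall F (j : ℤ)), Θ (1 + !![0, 0, 0; 0, 0, 0; z 0, z 1, 0]) ∂(Measure.pi fun _ : Fin 2 => dx)) *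
        ∫⁻ a : Fin 2 → Fin 3 → F, dx {t : F | (Matrix.of ![a 0, a 1, ![0, 0, t]] : Matrix (Fin 3) (Fin 3) F) ∈
            {X : Matrix (Fin 3) (Fin 3) F | (∀ i l, X i l ∈ 𝒪[F]) ∧ normAbs F X.det = 1}}
          ∂(Measure.pi fun _ : Fin 2 => Measure.pi fun _ : Fin 3 => dx) := by
  classical
  haveI : T2Space F := (isLocalField F).toT2Space
  haveI : LocallyCompactSpace F := (isLocalField F).toLocallyCompactSpace
  haveI : SecondCountableTopology F := secondCountableTopology_localField F
  set S : Set (Matrix (Fin 3) (Fin 3) F) := {X | (∀ i l, X i l ∈ 𝒪[F]) ∧ normAbs F X.det = 1} with hSdef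
  set T : Set (Matrix (Fin 3) (Fin 3) F) := {X | X 2 0 ∈ primePowBall F (j : ℤ) ∧ X 2 1 ∈ primePowBall F (j : ℤ)} with hTdef
  set ρ : Measure (Fin 3 → F) := Measure.pi fun _ : Fin 3 => dx with hρ
  have hSmeas : MeasurableSet S := measurableSet_setOf_integer_normAbs_det_eq_one
  have hTmeas : MeasurableSet T :=
    ((measurableSet_primePowBall _).preimage (continuous_id.matrix_elem 2 0).measurable).inter
      ((measurableSet_primePowBall _).preimage (continuous_id.matrix_elem 2 1).measurable)
  -- the integrand is Borel on `F^{3×3}`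
  have hG : Measurable fun X : Fin 3 → Fin 3 → F => (S ∩ T).indicator Θ (Matrix.of X) :=
    (hΘm.indicator (hSmeas.inter hTmeas)).comp (show Continuous (Matrix.of : (Fin 3 → Fin 3 → F) → Matrix (Fin 3) (Fin 3) F) from
      continuous_matrix fun i j => (continuous_apply j).comp (continuous_apply i)).measurable
  -- split off the last row
  let e : (Fin 3 → Fin 3 → F) ≃ᵐ (Fin 3 → F) × (Fin 2 → Fin 3 → F) := MeasurableEquiv.piFinSuccAbove (fun _ : Fin 3 => Fin 3 → F) 2
  have he : MeasurePreserving e (Measure.pi fun _ : Fin 3 => ρ) (ρ.prod (Measure.pi fun _ : Fin 2 => ρ)) :=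
    measurePreserving_piFinSuccAbove (fun _ : Fin 3 => ρ) 2
  rw [← he.symm.lintegral_comp_emb e.symm.measurableEmbedding,
    lintegral_prod_symm (fun p : (Fin 3 → F) × (Fin 2 → Fin 3 → F) => (S ∩ T).indicator Θ (Matrix.of (e.symm p)))
      (hG.comp e.symm.measurable).aemeasurable]
  -- the fibre identity, row by row
  have hfib : ∀ a : Fin 2 → Fin 3 → F, ∫⁻ c, (S ∩ T).indicator Θ (Matrix.of (e.symm (c, a))) ∂ρ =
      (∫⁻ z in Set.univ.pi (fun _ : Fin 2 => primePowBall F (j : ℤ)), Θ (1 + !![0, 0, 0; 0, 0, 0; z 0, z 1, 0]) ∂(Measure.pi fun _ : Fin 2 => dx)) *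
        dx {t : F | (Matrix.of ![a 0, a 1, ![0, 0, t]] : Matrix (Fin 3) (Fin 3) F) ∈ S} := by
    intro a
    simp_rw [show ∀ c, e.symm (c, a) = ![a 0, a 1, c] from fun c => piFinSuccAbove_rows_symm_apply c a]
    exact lintegral_fibre_levelIndicator_eq dx hj Θ hΘ hΘm a
  simp_rw [hfib]
  -- `a ↦ dx{t | P̃(a,t) ∈ S}` is Borel (section of a Borel set in the product)
  have hΨ : Measurable fun a : Fin 2 → Fin 3 → F => dx {t : F | (Matrix.of ![a 0, a 1, ![0, 0, t]] : Matrix (Fin 3) (Fin 3) F) ∈ S} :=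
    measurable_measure_prodMk_left (ν := dx) measurableSet_parabolicRows
  rw [lintegral_const_mul _ hΨ]

/-! ## §3  THE HEAD -/

variable [MeasurableSpace (Matrix (Fin 3) (Fin 3) F)] [BorelSpace (Matrix (Fin 3) (Fin 3) F)]
  [MeasurableSpace (GL (Fin 3) F)] [BorelSpace (GL (Fin 3) F)]

/-- **F″ — the level-`𝔭^j` parahoric set of `GL₃(𝒪)` against right-`(K ∩ P)`-invariant functions** (road owner K2E3-p11 (g5)'s frozen bytes; the leaf's
Borel structure on `M₃(F)` is a binder because `Measurable Θ` refers to it): there is ONE constant `c ∈ (0, ∞)` such that for every level `j ≥ 1` and every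
Borel `Θ ≥ 0` on `M₃(F)` with `Θ(g p) = Θ(g)` whenever `p ∈ M₃(𝒪)`, `‖det p‖ = 1`, `p₂₀ = p₂₁ = 0`:
  `∫_{k ∈ GL₃(𝒪), k₂₀ ∈ 𝔭^j, k₂₁ ∈ 𝔭^j} Θ(k) dκ = c · ∫_{z ∈ (𝔭^j)²} Θ(1 + L z) dz`.
(★ C `κ = c₀ μ𝔤|_S` for the row-product Haar measure transported to `M₃(F)`; §2; `c = c₀·V`; non-degeneracy from `j = 1`, `Θ = 1`.)
[cite: Macdonald1971, (1.4), (2.1)] [cite: WeilBNT1967, Ch. I §2; Ch. II §2] [cite: BushnellHenniart2006, §7.2] -/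
theorem exists_lintegral_glInt_lowerLevel_eq (κ : Measure ↥(glInt 3 F)) [IsHaarMeasure κ] (dx : Measure F) [dx.IsAddHaarMeasure] :
    ∃ c : ℝ≥0∞, c ≠ 0 ∧ c ≠ ⊤ ∧ ∀ j : ℕ, 1 ≤ j → ∀ Θ : Matrix (Fin 3) (Fin 3) F → ℝ≥0∞, Measurable Θ →
      (∀ g p : Matrix (Fin 3) (Fin 3) F, (∀ i l, p i l ∈ 𝒪[F]) → normAbs F p.det = 1 → p 2 0 = 0 → p 2 1 = 0 → Θ (g * p) = Θ g) →
      ∫⁻ k in {k : ↥(glInt 3 F) | ((k : GL (Fin 3) F) : Matrix (Fin 3) (Fin 3) F) 2 0 ∈ primePowBall F j ∧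
          ((k : GL (Fin 3) F) : Matrix (Fin 3) (Fin 3) F) 2 1 ∈ primePowBall F j}, Θ ((k : GL (Fin 3) F) : Matrix (Fin 3) (Fin 3) F) ∂κ =
        c * ∫⁻ z in Set.univ.pi (fun _ : Fin 2 => primePowBall F (j : ℤ)), Θ (1 + !![0, 0, 0; 0, 0, 0; z 0, z 1, 0]) ∂(Measure.pi fun _ : Fin 2 => dx) := by
  classical
  haveI : T2Space F := (isLocalField F).toT2Space
  haveI : LocallyCompactSpace F := (isLocalField F).toLocallyCompactSpace
  haveI : SecondCountableTopology F := secondCountableTopology_localField F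
  haveI : MeasurableAdd (Fin 3 → F) := inferInstance
  haveI : (Measure.pi fun _ : Fin 3 => dx).IsAddHaarMeasure := inferInstance
  haveI : (Measure.pi fun _ : Fin 3 => Measure.pi fun _ : Fin 3 => dx).IsAddHaarMeasure := Measure.pi.isAddHaarMeasure _
  -- `F^{3×3} ≃ M₃(F)` as a measurable equivalence between the product Borel structure and the given (Borel) one
  have hofc : Continuous (Matrix.of : (Fin 3 → Fin 3 → F) → Matrix (Fin 3) (Fin 3) F) :=
    continuous_matrix fun i j => (continuous_apply j).comp (continuous_apply i)
  have hofsc : Continuous (Matrix.of.symm : Matrix (Fin 3) (Fin 3) F → (Fin 3 → Fin 3 → F)) :=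
    continuous_pi fun i => continuous_pi fun j => continuous_id.matrix_elem i j
  let eM : (Fin 3 → Fin 3 → F) ≃ᵐ Matrix (Fin 3) (Fin 3) F :=
    { toEquiv := Matrix.of
      measurable_toFun := hofc.measurable
      measurable_invFun := hofsc.measurable }
  -- the transported row-product Haar measure on `M₃(F)`
  haveI hμ𝔤 : ((Measure.pi fun _ : Fin 3 => Measure.pi fun _ : Fin 3 => dx).map eM).IsAddHaarMeasure :=
    AddEquiv.isAddHaarMeasure_map (Measure.pi fun _ : Fin 3 => Measure.pi fun _ : Fin 3 => dx)
      (Matrix.ofAddEquiv : (Fin 3 → Fin 3 → F) ≃+ Matrix (Fin 3) (Fin 3) F) hofc hofsc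
  have hSmeas : MeasurableSet {X : Matrix (Fin 3) (Fin 3) F | (∀ i j, X i j ∈ 𝒪[F]) ∧ normAbs F X.det = 1} :=
    measurableSet_setOf_integer_normAbs_det_eq_one
  have hcoec : Continuous fun k : ↥(glInt 3 F) => ((k : GL (Fin 3) F) : Matrix (Fin 3) (Fin 3) F) :=
    Units.continuous_val.comp continuous_subtype_val
  -- ★ C
  obtain ⟨c₀, hc₀0, hc₀top, hC⟩ :=
    exists_lintegral_glInt_eq_mul_setLIntegral (N := 3) ((Measure.pi fun _ : Fin 3 => Measure.pi fun _ : Fin 3 => dx).map eM) κ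
  -- the level-free volume factor
  obtain ⟨V, hV⟩ : ∃ V : ℝ≥0∞, V = ∫⁻ a : Fin 2 → Fin 3 → F, dx {t : F | (Matrix.of ![a 0, a 1, ![0, 0, t]] : Matrix (Fin 3) (Fin 3) F) ∈
      {X : Matrix (Fin 3) (Fin 3) F | (∀ i l, X i l ∈ 𝒪[F]) ∧ normAbs F X.det = 1}} ∂(Measure.pi fun _ : Fin 2 => Measure.pi fun _ : Fin 3 => dx) :=
    ⟨_, rfl⟩
  -- the identity with `c = c₀ · V`
  have main : ∀ j : ℕ, 1 ≤ j → ∀ Θ : Matrix (Fin 3) (Fin 3) F → ℝ≥0∞, Measurable Θ →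
      (∀ g p : Matrix (Fin 3) (Fin 3) F, (∀ i l, p i l ∈ 𝒪[F]) → normAbs F p.det = 1 → p 2 0 = 0 → p 2 1 = 0 → Θ (g * p) = Θ g) →
      ∫⁻ k in {k : ↥(glInt 3 F) | ((k : GL (Fin 3) F) : Matrix (Fin 3) (Fin 3) F) 2 0 ∈ primePowBall F j ∧
          ((k : GL (Fin 3) F) : Matrix (Fin 3) (Fin 3) F) 2 1 ∈ primePowBall F j}, Θ ((k : GL (Fin 3) F) : Matrix (Fin 3) (Fin 3) F) ∂κ =
        c₀ * V * ∫⁻ z in Set.univ.pi (fun _ : Fin 2 => primePowBall F (j : ℤ)), Θ (1 + !![0, 0, 0; 0, 0, 0; z 0, z 1, 0])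
          ∂(Measure.pi fun _ : Fin 2 => dx) := by
    intro j hj Θ hΘm hΘ
    have hTmeas : MeasurableSet {X : Matrix (Fin 3) (Fin 3) F | X 2 0 ∈ primePowBall F (j : ℤ) ∧ X 2 1 ∈ primePowBall F (j : ℤ)} :=
      ((measurableSet_primePowBall _).preimage (continuous_id.matrix_elem 2 0).measurable).inter
        ((measurableSet_primePowBall _).preimage (continuous_id.matrix_elem 2 1).measurable)
    -- the level set is the preimage of `T_j`, so the left-hand side is `∫_K (1_{T_j} Θ)(↑↑k) dκ`
    have hL : ∫⁻ k in {k : ↥(glInt 3 F) | ((k : GL (Fin 3) F) : Matrix (Fin 3) (Fin 3) F) 2 0 ∈ primePowBall F j ∧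
          ((k : GL (Fin 3) F) : Matrix (Fin 3) (Fin 3) F) 2 1 ∈ primePowBall F j}, Θ ((k : GL (Fin 3) F) : Matrix (Fin 3) (Fin 3) F) ∂κ =
        ∫⁻ k : ↥(glInt 3 F), {X : Matrix (Fin 3) (Fin 3) F | X 2 0 ∈ primePowBall F (j : ℤ) ∧ X 2 1 ∈ primePowBall F (j : ℤ)}.indicator Θ
          ((k : GL (Fin 3) F) : Matrix (Fin 3) (Fin 3) F) ∂κ := by
      have hK : {k : ↥(glInt 3 F) | ((k : GL (Fin 3) F) : Matrix (Fin 3) (Fin 3) F) 2 0 ∈ primePowBall F (j : ℤ) ∧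
            ((k : GL (Fin 3) F) : Matrix (Fin 3) (Fin 3) F) 2 1 ∈ primePowBall F (j : ℤ)} =
          (fun k : ↥(glInt 3 F) => ((k : GL (Fin 3) F) : Matrix (Fin 3) (Fin 3) F)) ⁻¹'
            {X : Matrix (Fin 3) (Fin 3) F | X 2 0 ∈ primePowBall F (j : ℤ) ∧ X 2 1 ∈ primePowBall F (j : ℤ)} := rfl
      rw [hK, ← lintegral_indicator (hTmeas.preimage hcoec.measurable)]
      refine lintegral_congr fun k => ?_
      exact Set.indicator_comp_right (fun k : ↥(glInt 3 F) => ((k : GL (Fin 3) F) : Matrix (Fin 3) (Fin 3) F)) (g := Θ)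
    -- ★ C, then back to `F^{3×3}` along `eM`
    have hconv : ∫⁻ X in {X : Matrix (Fin 3) (Fin 3) F | (∀ i j, X i j ∈ 𝒪[F]) ∧ normAbs F X.det = 1},
          {X : Matrix (Fin 3) (Fin 3) F | X 2 0 ∈ primePowBall F (j : ℤ) ∧ X 2 1 ∈ primePowBall F (j : ℤ)}.indicator Θ X
          ∂((Measure.pi fun _ : Fin 3 => Measure.pi fun _ : Fin 3 => dx).map eM) =
        ∫⁻ Y : Fin 3 → Fin 3 → F, ({X : Matrix (Fin 3) (Fin 3) F | (∀ i l, X i l ∈ 𝒪[F]) ∧ normAbs F X.det = 1} ∩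
          {X : Matrix (Fin 3) (Fin 3) F | X 2 0 ∈ primePowBall F (j : ℤ) ∧ X 2 1 ∈ primePowBall F (j : ℤ)}).indicator Θ (Matrix.of Y)
          ∂(Measure.pi fun _ : Fin 3 => Measure.pi fun _ : Fin 3 => dx) := by
      rw [← lintegral_indicator hSmeas, Set.indicator_indicator]
      exact lintegral_map_equiv _ eM
    rw [hL, hC _ (hΘm.indicator hTmeas), hconv, lintegral_pi_levelIndicator_eq dx hj Θ hΘ hΘm, ← hV]
    ring
  refine ⟨c₀ * V, ?_, ?_, main⟩
  · -- `c ≠ 0`: the level-`𝔭` set is an open neighbourhood of `1` in `GL₃(𝒪)`, so it has positive Haar measure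
    intro hc
    have h := main 1 le_rfl (fun _ => 1) measurable_const (fun _ _ _ _ _ _ => rfl)
    simp only [lintegral_const, Measure.restrict_apply_univ, one_mul, hc, zero_mul] at h
    refine (IsOpen.measure_pos κ ?_ ⟨1, ?_⟩).ne' h
    · rw [Set.setOf_and]
      exact ((isOpen_primePowBall _).preimage ((continuous_id.matrix_elem 2 0).comp hcoec)).inter
        ((isOpen_primePowBall _).preimage ((continuous_id.matrix_elem 2 1).comp hcoec))
    · refine ⟨?_, ?_⟩ <;> simp [zero_mem_primePowBall]
  · -- `c ≠ ⊤`: the level-`𝔭` set has finite Haar measure (compact group) and `dx(𝔭)² > 0`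
    intro hc
    have h := main 1 le_rfl (fun _ => 1) measurable_const (fun _ _ _ _ _ _ => rfl)
    simp only [lintegral_const, Measure.restrict_apply_univ, one_mul, hc] at h
    haveI : CompactSpace ↥(glInt 3 F) := isCompact_iff_compactSpace.1 (isCompact_glInt 3 F)
    refine (measure_lt_top κ _).ne (h.trans (ENNReal.top_mul ?_))
    rw [Measure.pi_pi]
    exact Finset.prod_ne_zero_iff.2 fun _ _ => (addHaar_primePowBall_pos dx _).ne'

end Summit.HodgeConjecture.HodgeConjecture.Cruxes.H413.K2E3GL3ParahoricLevelMeasure
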